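/-
Chen 2024 (IACR ePrint 2024/555, version of 2024-04-18), §3.5.6 pp. 27–29: Step 6, `|φ₆⟩ := QFT_{ℤ_Mⁿ}|φ₅⟩`,
EXACTLY, for the untruncated states.  The three register operations of Steps 4–6 — `QFT_{ℤ_Pⁿ}` (Step 4),
the digit split `h = h′·N + h″` with the measurement `h″ = h*` (Step 5, `P = M·N`), `QFT_{ℤ_Mⁿ}` on the
surviving high digits (Step 6) — compose to ONE finite identity (decimation in frequency): the result is
`Mⁿ` times the PARTIAL Fourier sum of the Step-3 amplitudes over the coset `{v ∈ ℤ_Pⁿ : v ≡ −c (mod M)}`,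
twisted by the measured `h*`.  Unfolding the periodised window of Step 3 then gives `|φ₆⟩` in closed form as
a Gaussian series over the shifted lattice `Mℤⁿ − c`, and Poisson summation over the lattice index gives
its dual forms — the exact objects whose approximate shape (after the paper's parameter choices and up to
`2^{−Ω(n)}`) Lemmas 3.27–3.29 / eq. (27)–(29) assert.  The role of Cond. C.5 ("the key condition for
creating the Karst wave") becomes an exact statement: C.5 says `Im(b·M²) = −2` for the rate `b` of the
complex Gaussian, so the lattice chirp `e^{2πi‖J‖²} = 1` can be removed before Poisson summation, leaving a
REAL rate `Re(b)M² = σ²/N²` and genuinely concentrated dual Gaussians.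

REPRODUCTION / ANALYSIS OF A CLAIMED RESULT UNDER ADJUDICATION (withdrawn by its author, note of 2024-04-18).
HONEST FRAMING: the VALUE is a THEOREM / DECIDABLE VERDICT / CERTIFICATE / precise negative result — NOT
summit progress.  Theorems about a WITHDRAWN algorithm: they certify the exact content of Steps 4–6 for
the untruncated states and for EVERY pair of measurement outcomes `(z′, h*)`; nothing is repaired, nothing
is broken, no cryptanalytic claim (the defect of the paper is the periodicity premise of Lemma 2.17 in
Step 9, `ChenQuantumLWESteps`).  The `≈` statements of Lemmas 3.27–3.29 (eq. (27)–(29)) and all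
truncations are NOT treated.  No named fact is introduced (debt 0).
-/
import Literature.Computability.Cryptography.ChenQuantumLWEStepFive

/-!
# Chen 2024, Step 6: `|φ₆⟩ := QFT_{ℤ_Mⁿ}|φ₅⟩` — Steps 4–6 as one partial Fourier transform, exactly

Setting (§3.5.4–3.5.6, pp. 25–29; Cond. C.2 p. 18: `P = M·N`, `N = t² + u²`).  `|φ₃⟩` (eq. (21), `phi3`) is a
state of `n` registers `ℤ_P`; Step 4 applies `QFT_{ℤ_Pⁿ}` (`phi4`); Step 5 reads `h = h′·N + h″` and measures
the low digits `h″ = h* ∈ ℤ_Nⁿ`, leaving the slice `|φ₅⟩(h′) = |φ₄⟩(h′N + h*)` (`phi5`); Step 6 applies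
`QFT_{ℤ_Mⁿ}` to `h′`: `|φ₆⟩ := QFT_{ℤ_Mⁿ}|φ₅⟩` (`phi6`, p. 27 "Step 6 simply applies QFT_{ℤ_Mⁿ} on |φ₅⟩").
All transforms are Chen's unnormalised `qft` (Lemma 2.12, kernel `e^{−2πi⟨·,·⟩/m}`).

Results (exact, every constant explicit; `ṽ ∈ [0,P)ⁿ`, `c̃ ∈ [0,M)ⁿ`, `h̃* ∈ [0,N)ⁿ` the representatives):
* `qft_slice_qft` — **decimation in frequency** for ANY `f : ℤ_Pⁿ → ℂ`:
  `QFT_{ℤ_Mⁿ}(h′ ↦ (QFT_{ℤ_Pⁿ} f)(h′N + h*))(c) = Mⁿ · Σ_{v ∈ ℤ_Pⁿ, M ∣ ṽ + c̃} f(v) e^{−2πi⟨ṽ,h̃*⟩/P}`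
  (change of modulus `ψ_P(N·w) = ψ_M(w)` and orthogonality of characters on `ℤ_Mⁿ`).
* `phi6_apply` — hence `|φ₆⟩(c) = Mⁿ Σ_{v ≡ −c (mod M)} |φ₃⟩(v) e^{−2πi⟨ṽ,h̃*⟩/P}` for every `a, b, x, y, z′, h*`:
  Steps 4–6 read off the restriction of `|φ₃⟩` to one coset of `Mℤ_Pⁿ`, twisted by `h*`.
* `tsum_pi_int_eq_sum_residue` — summing a series over `ℤⁿ` by residue classes mod `P` (folklore helper).
* `phi6_eq_tsum` — unfolding the periodised window of Step 3 (`window`, `pgauss`): `|φ₆⟩(c) = Mⁿ Σ_{J∈ℤⁿ}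
  f₂((MJ − c̃) mod P) · e^{−πb‖MJ − c̃ − z′‖²} · e^{−2πi⟨MJ − c̃, h̃*⟩/P}` with `f₂ = QFT_{ℤ_Pⁿ}|φ′₁⟩` the exact
  Step-2 amplitude (eq. (18), `qft_phi1Prime`): a complex Gaussian ball of rate `b` centred at `z′ + c̃`
  sampled on the lattice `Mℤⁿ`, weighted by the line function `f₂` and twisted by `h*` — the exact
  counterpart of eq. (27) (`Σ_{k∈ℤⁿ} exp(−π‖c + Mk + …‖²…)`, stated there with `≈` and for `M = 2(t²+u²)`).
* `phi6_eq27_exact` — the same with `f₂` written out (`Re a > 0`, `x ≠ 0`): a double series over the line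
  index `k ∈ ℤ` and the lattice index `J ∈ ℤⁿ`, phases split as `e(⟨c̃, h̃* + kx − y⟩/P)·e(−⟨J, h̃* + kx − y⟩/N)`.
* `phi6_eq27_exact_comm` — the same with the two sums exchanged (Fubini on `ℤⁿ × ℤ`, dominated by the product
  of the two absolutely convergent Gaussian families) and the `J`-free factors pulled out.
* `tsum_lattice_gauss_char` — Poisson summation over the lattice index for a character-twisted Gaussian on
  `Mℤⁿ − w` (coordinatewise Lemma 2.4 / eq. (1)–(2), via `tsum_cexp_neg_quadratic_shift`), complex rate `bM²`.
* `tsum_lattice_gauss_char_shift` — the same after removing an even chirp: for any `κ ∈ ℤ`, `e^{2πiκ‖J‖²} = 1`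
  on `ℤⁿ`, so the rate may be traded for `bM² + 2κi` (extra character `e^{−4πiκ⟨w,J⟩/M}`, constant
  `e^{2πiκ‖w/M‖²}`) BEFORE Poisson summation; when `Im(bM²) = −2κ` the new rate is real.
* `rate_shift_of_C5` — pure real algebra: for Chen's `b = t²r²s²(s²−r²i)/(P²u²(s⁴+r⁴))`, `N = t²+u²`,
  `P = MN`, Cond. C.5 gives `bM² + 2i = σ²/N²` (`σ² = r²s⁴t²/(u²(r⁴+s⁴))`, C.6): C.5 is `Im(bM²) = −2`.
* `phi6_dual` — `|φ₆⟩` after Fubini and Poisson summation in `J` with the complex rate: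
  `Mⁿ(bM²)^{−n/2} Σ_k e^{−πa‖kx−y‖²} e(⟨s_k,c̃⟩/P) ∏ᵢ Σ_{ξ∈ℤ} e^{−(π/(bM²))(ξ + s_{k,i}/N)²} e^{−2πi(c̃ᵢ+z′ᵢ)(ξ + s_{k,i}/N)/M}`,
  `s_k = kx − y + h̃*` (for Chen's nearly imaginary `b` this form does NOT localise by itself — see the CAUTION
  in its docstring).
* `phi6_karst` — `|φ₆⟩` after the chirp shift by `κ ∈ ℤ` and Poisson summation in `J`: dual rate
  `1/(bM² + 2κi)`, dual centres `θ_{k,i} = s_{k,i}/N + 2κ(c̃ᵢ+z′ᵢ)/M`.  Under C.5 (`κ = 1`, `M = 2N`) the dual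
  Gaussians are `e^{−π(N/σ)²(ξ+θ)²}`, concentrated at `θ_{k,i} = 2(kxᵢ − yᵢ + h̃*ᵢ + c̃ᵢ + z′ᵢ)/M ∈ ℤ`:
  `c ≡ −(z′ + h* − y) − kx (mod M/2)` up to width `σ` — the lattice of centres `(M/2)k_c − (z′+h*−y)` and the
  "Gaussian balls of width σ" of eq. (27)–(29), obtained here as an exact identity (the paper's `≈`-claims,
  parameters beyond C.5, truncations and error terms are NOT reproduced; the sum over `k` is not resummed).

[cite: ChenQuantumLattice2024, §3.5.6, eq. (27)–(29), p. 27–29; §3.5.4–3.5.5 p. 25–27; Cond. C.2, C.5, C.6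
p. 18–19; §1.2 p. 3–4; Lemma 2.4 p. 10; Lemma 2.12 p. 12]
-/

namespace Literature.Computability.Cryptography.Chen2024

open scoped BigOperators Real
open Complex hiding exp continuous_exp exp_add

noncomputable section

section StepSix

variable {n : ℕ}

/-! ### Decimation in frequency: `QFT_{ℤ_Mⁿ} ∘ (slice at h*) ∘ QFT_{ℤ_Pⁿ}` -/

/-- **Decimation in frequency (Steps 4–6 for an arbitrary input).**  For `P = M·N`, any `f : ℤ_Pⁿ → ℂ`,
any low digits `h* ∈ ℤ_Nⁿ` and any `c ∈ ℤ_Mⁿ`: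
`QFT_{ℤ_Mⁿ}(h′ ↦ (QFT_{ℤ_Pⁿ} f)(h′·N + h*))(c) = Mⁿ · Σ_{v ∈ ℤ_Pⁿ, M ∣ ṽᵢ + c̃ᵢ ∀ i} f(v) · e(−⟨ṽ, h̃*⟩/P)`.
Proof: `⟨v, h′N + h*⟩/P = ⟨ṽ, h̃′⟩/M + ⟨ṽ, h̃*⟩/P`, then `Σ_{h′∈ℤ_Mⁿ} e(−⟨ṽ + c̃, h′⟩/M) = Mⁿ·[M ∣ ṽ + c̃]`.
[folklore] [cite: ChenQuantumLattice2024, Lemma 2.12 p. 12; §3.5.5–3.5.6 p. 26–27] -/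
theorem qft_slice_qft {P M N : ℕ} [NeZero P] [NeZero M] [NeZero N] (hP : P = M * N)
    (f : Ket n P) (hs : Fin n → ZMod N) (c : Fin n → ZMod M) :
    qft (fun h' : Fin n → ZMod M => qft f (joinVec P N h' hs)) c
      = (M : ℂ) ^ n * ∑ v ∈ Finset.univ.filter
          (fun v : Fin n → ZMod P => ∀ i, M ∣ (v i).val + (c i).val),
          f v * e (-(((∑ i, (v i).val * (hs i).val : ℕ) : ℚ) / P)) := by
  classical
  have hPZ : ((P : ℕ) : ℤ) = (N : ℤ) * (M : ℤ) := by rw [hP]; push_cast; ring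
  -- the character of the joined register factorises: `ψ_P(−⟨v, h′N + h*⟩) = ψ_M(−⟨ṽ, h′⟩)·ψ_P(−⟨v, h̃*⟩)`
  have key : ∀ (v : Fin n → ZMod P) (h' : Fin n → ZMod M),
      ZMod.stdAddChar (-(∑ t, v t * joinVec P N h' hs t))
        = ZMod.stdAddChar (-(∑ t, (((v t).val : ℕ) : ZMod M) * h' t))
          * ZMod.stdAddChar (-(∑ t, v t * (((hs t).val : ℕ) : ZMod P))) := by
    intro v h'
    have h2 : ∀ t, v t * joinVec P N h' hs t
        = (N : ZMod P) * ((((v t).val : ℕ) : ZMod P) * (((h' t).val : ℕ) : ZMod P))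
          + v t * (((hs t).val : ℕ) : ZMod P) := by
      intro t
      rw [ZMod.natCast_zmod_val (v t)]
      simp only [joinVec, digitJoin]
      push_cast
      ring
    have h1 : -(∑ t, v t * joinVec P N h' hs t)
        = (((N : ℤ) * -(∑ t, ((v t).val : ℤ) * ((h' t).val : ℤ)) : ℤ) : ZMod P)
          + -(∑ t, v t * (((hs t).val : ℕ) : ZMod P)) := by
      simp only [h2]
      rw [Finset.sum_add_distrib, ← Finset.mul_sum]
      push_cast
      ring
    rw [h1, AddChar.map_add_eq_mul, stdAddChar_intCast_mul P M N _ hPZ]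
    congr 2
    push_cast
    simp only [ZMod.natCast_zmod_val]
  -- the phase of the statement is the `ψ_P`-factor of `key`
  have hB : ∀ v : Fin n → ZMod P, e (-(((∑ i, (v i).val * (hs i).val : ℕ) : ℚ) / P))
      = ZMod.stdAddChar (-(∑ t, v t * (((hs t).val : ℕ) : ZMod P))) := by
    intro v
    rw [e_neg_natCast_div]
    congr 2
    push_cast
    simp only [ZMod.natCast_zmod_val]
  -- orthogonality of characters on `ℤ_Mⁿ`, one `v` at a time
  have inner : ∀ v : Fin n → ZMod P,
      ∑ h' : Fin n → ZMod M, f v * (ZMod.stdAddChar (-(∑ t, (((v t).val : ℕ) : ZMod M) * h' t))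
          * ZMod.stdAddChar (-(∑ t, v t * (((hs t).val : ℕ) : ZMod P))))
          * ZMod.stdAddChar (-(∑ t, h' t * c t))
        = if (∀ i, M ∣ (v i).val + (c i).val) then
            (M : ℂ) ^ n * (f v * e (-(((∑ i, (v i).val * (hs i).val : ℕ) : ℚ) / P))) else 0 := by
    intro v
    set w : Fin n → ZMod M := fun t => -((((v t).val : ℕ) : ZMod M) + c t) with hw
    have hAC : ∀ h' : Fin n → ZMod M,
        ZMod.stdAddChar (-(∑ t, (((v t).val : ℕ) : ZMod M) * h' t))
            * ZMod.stdAddChar (-(∑ t, h' t * c t))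
          = ZMod.stdAddChar (∑ t, w t * h' t) := by
      intro h'
      rw [← AddChar.map_add_eq_mul]
      congr 1
      rw [← Finset.sum_neg_distrib, ← Finset.sum_neg_distrib, ← Finset.sum_add_distrib]
      exact Finset.sum_congr rfl fun t _ => by rw [hw]; ring
    have h3 : ∀ h' : Fin n → ZMod M,
        f v * (ZMod.stdAddChar (-(∑ t, (((v t).val : ℕ) : ZMod M) * h' t))
          * ZMod.stdAddChar (-(∑ t, v t * (((hs t).val : ℕ) : ZMod P))))
          * ZMod.stdAddChar (-(∑ t, h' t * c t))
        = f v * ZMod.stdAddChar (-(∑ t, v t * (((hs t).val : ℕ) : ZMod P)))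
          * (ZMod.stdAddChar (-(∑ t, (((v t).val : ℕ) : ZMod M) * h' t))
            * ZMod.stdAddChar (-(∑ t, h' t * c t))) := fun h' => by ring
    simp only [h3, hAC]
    rw [← Finset.mul_sum, sum_stdAddChar_linForm w]
    have hw0 : w = 0 ↔ ∀ i, M ∣ (v i).val + (c i).val := by
      simp only [hw, funext_iff, Pi.zero_apply, neg_eq_zero]
      refine forall_congr' fun i => ?_
      rw [← ZMod.natCast_eq_zero_iff, Nat.cast_add, ZMod.natCast_zmod_val (c i)]
    by_cases hc : ∀ i, M ∣ (v i).val + (c i).val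
    · rw [if_pos (hw0.mpr hc), if_pos hc, hB v]
      ring
    · rw [if_neg (mt hw0.mp hc), if_neg hc, mul_zero]
  rw [qft_apply_eq_sum_stdAddChar]
  simp_rw [qft_apply_eq_sum_stdAddChar, key, Finset.sum_mul]
  rw [Finset.sum_comm, Finset.mul_sum, Finset.sum_filter]
  exact Finset.sum_congr rfl fun v _ => inner v

/-! ### `|φ₆⟩` and its coset form -/

/-- **`|φ₆⟩ := QFT_{ℤ_Mⁿ}|φ₅⟩`** (Step 6, §3.5.6 p. 27), unnormalised, as a function of `c ∈ ℤ_Mⁿ`, for the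
untruncated states and the measurement outcomes `z′` (Step 3) and `h*` (Step 5).
[cite: ChenQuantumLattice2024, §3.5.6 p. 27] -/
def phi6 (P N : ℕ) [NeZero P] {M : ℕ} [NeZero M] (a b : ℂ) (x y z' : Fin n → ℤ)
    (hs : Fin n → ZMod N) : Ket n M :=
  qft (phi5 P N a b x y z' hs)

/-- **T1 — `|φ₆⟩` is a partial Fourier transform of `|φ₃⟩` (Steps 4–6 exactly).**  For `P = M·N` and
EVERY `a, b, x, y, z′, h*`: `|φ₆⟩(c) = Mⁿ · Σ_{v ∈ ℤ_Pⁿ, v ≡ −c (mod M)} |φ₃⟩(v) · e(−⟨ṽ, h̃*⟩/P)`.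
No analytic hypothesis is needed: this is finite Fourier bookkeeping (`qft_slice_qft`).
[cite: ChenQuantumLattice2024, §3.5.4–3.5.6 p. 25–27] -/
theorem phi6_apply {P M N : ℕ} [NeZero P] [NeZero M] [NeZero N] (hP : P = M * N) (a b : ℂ)
    (x y z' : Fin n → ℤ) (hs : Fin n → ZMod N) (c : Fin n → ZMod M) :
    phi6 P N a b x y z' hs c
      = (M : ℂ) ^ n * ∑ v ∈ Finset.univ.filter
          (fun v : Fin n → ZMod P => ∀ i, M ∣ (v i).val + (c i).val),
          phi3 P a b x y z' v * e (-(((∑ i, (v i).val * (hs i).val : ℕ) : ℚ) / P)) := by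
  unfold phi6 phi5 phi4
  exact qft_slice_qft hP (phi3 P a b x y z') hs c


/-! ### Summing over `ℤⁿ` by residue classes -/

/-- `ℤⁿ ≃ ℤ_Pⁿ × ℤⁿ` coordinatewise, `w ↦ (w mod P, ⌊w/P⌋)`, inverse `(v, m) ↦ ṽ + P·m`
(`intResidueClassesEquiv` of `ChenQuantumLWEKarstWave` on every coordinate).
[folklore] [cite: ChenQuantumLattice2024, eq. (21) p. 25] -/
def piResidueClassesEquiv (n P : ℕ) [NeZero P] : (Fin n → ℤ) ≃ (Fin n → ZMod P) × (Fin n → ℤ) :=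
  (Equiv.piCongrRight fun _ : Fin n => intResidueClassesEquiv P).trans
    (Equiv.arrowProdEquivProdArrow (Fin n) (fun _ => ZMod P) fun _ => ℤ)

/-- A summable series over `ℤⁿ` may be summed residue class by residue class modulo `P`:
`Σ_{w∈ℤⁿ} g(w) = Σ_{v∈ℤ_Pⁿ} Σ_{m∈ℤⁿ} g(ṽ + P·m)` (`ṽ ∈ [0,P)ⁿ` the representative) — the bookkeeping
behind "`Σ_{z∈ℤⁿ} (…) |z mod P⟩`" in eq. (21). [folklore] [cite: ChenQuantumLattice2024, eq. (21) p. 25] -/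
theorem tsum_pi_int_eq_sum_residue (P : ℕ) [NeZero P] {g : (Fin n → ℤ) → ℂ} (hg : Summable g) :
    ∑' w : Fin n → ℤ, g w
      = ∑ v : Fin n → ZMod P, ∑' m : Fin n → ℤ, g (fun i => ((v i).val : ℤ) + P * m i) := by
  rw [← (piResidueClassesEquiv n P).symm.tsum_eq g, Summable.tsum_prod, tsum_fintype]
  · rfl
  · exact hg.comp_injective (piResidueClassesEquiv n P).symm.injective

/-! ### The lattice-coset form of `|φ₆⟩` (the exact counterpart of eq. (27)) -/

/-- `e(z) = 1` for `z ∈ ℤ` (local copy; the public version lives in `ChenQuantumLWEStepEight`, which is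
not imported here). [folklore] -/
private theorem e_int (z : ℤ) : e (z : ℚ) = 1 := by
  rw [e, show (2 * (π : ℂ) * I * ((z : ℚ) : ℂ)) = z * (2 * π * I) by push_cast; ring,
    Complex.exp_int_mul_two_pi_mul_I]

/-- `e(q) = e(q′)` whenever `q − q′ ∈ ℤ`. [folklore] -/
private theorem e_eq_of_sub_int {q q' : ℚ} (z : ℤ) (h : q - q' = z) : e q = e q' := by
  rw [show q = q' + z by rw [← h]; ring, e_add, e_int, mul_one]

/-- Reading an integer vector through its residues mod `P` does not change the phase `e(−⟨·, h̃⟩/P)`: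
`e(−Σᵢ (wᵢ mod P)·hᵢ/P) = e(−Σᵢ wᵢhᵢ/P)`. [folklore] -/
private theorem e_val_repr (P : ℕ) [NeZero P] (w : Fin n → ℤ) (h : Fin n → ℕ) :
    e (-(((∑ i, (((w i : ℤ) : ZMod P)).val * h i : ℕ) : ℚ) / P))
      = e (-(((∑ i, w i * (h i : ℤ) : ℤ) : ℚ) / P)) := by
  refine e_eq_of_sub_int (∑ i, (w i / P) * (h i : ℤ)) ?_
  have hr : ∀ i, (((((w i : ℤ) : ZMod P)).val : ℕ) : ℤ) = w i - P * (w i / P) := by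
    intro i
    rw [ZMod.val_intCast, Int.emod_def]
  have hP0 : (P : ℚ) ≠ 0 := by exact_mod_cast NeZero.ne P
  rw [neg_sub_neg, ← sub_div, div_eq_iff hP0]
  push_cast
  rw [← Finset.sum_sub_distrib, Finset.sum_mul]
  refine Finset.sum_congr rfl fun i _ => ?_
  have hri : (((((w i : ℤ) : ZMod P)).val : ℕ) : ℚ) = (w i : ℚ) - (P : ℚ) * ((w i / P : ℤ) : ℚ) := by
    exact_mod_cast hr i
  rw [hri]
  ring

/-- **T2 — `|φ₆⟩` as a Gaussian series over the shifted lattice `Mℤⁿ − c̃` (Step 6 in closed form).**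
For `P = M·N`, `Re b > 0` and EVERY `a, x, y, z′, h*, c` (`c̃ ∈ [0,M)ⁿ`, `h̃* ∈ [0,N)ⁿ` representatives):
`|φ₆⟩(c) = Mⁿ · Σ_{J∈ℤⁿ} f₂((MJ − c̃) mod P) · e^{−πb‖MJ − c̃ − z′‖²} · e(−⟨MJ − c̃, h̃*⟩/P)`, where
`f₂ = QFT_{ℤ_Pⁿ}|φ′₁⟩` is the exact Step-2 amplitude (eq. (18), `qft_phi1Prime`; `P`-periodic on `ℤⁿ`).
Ingredients on top of `phi6_apply`: the window of Step 3 is `Σ_{m∈ℤⁿ} e^{−πb‖ṽ + Pm − z′‖²}`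
(`prod_tsum_int`), `{ṽ + Pm : v ≡ −c (M), m ∈ ℤⁿ} = Mℤⁿ − c̃` because `M ∣ P`
(`tsum_pi_int_eq_sum_residue`, `Function.Injective.tsum_eq`), and `e(−⟨ṽ,h̃*⟩/P) = e(−⟨w,h̃*⟩/P)` for
`w ≡ ṽ (P)`.  This is the exact object behind Lemma 3.27 / eq. (27) (there: `M = 2(t²+u²)`, Gaussian
`exp(−π‖c + Mk + 2Djx − …‖²/σ²)` over `k ∈ ℤⁿ`, with `≈`); no `≈`, no parameter constraint here.
[cite: ChenQuantumLattice2024, §3.5.6 Lemma 3.27 eq. (27) p. 27–28; eq. (21) p. 25; Cond. C.2 p. 18] -/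
theorem phi6_eq_tsum {P M N : ℕ} [NeZero P] [NeZero M] [NeZero N] (hP : P = M * N) (a : ℂ) {b : ℂ}
    (hb : 0 < b.re) (x y z' : Fin n → ℤ) (hs : Fin n → ZMod N) (c : Fin n → ZMod M) :
    phi6 P N a b x y z' hs c = (M : ℂ) ^ n * ∑' J : Fin n → ℤ,
      qft (phi1Prime P a x y) (fun i => (((M : ℤ) * J i - (c i).val : ℤ) : ZMod P)) *
        cexp (-π * b * ∑ i, ((((M : ℤ) * J i - (c i).val - z' i : ℤ)) : ℂ) ^ 2) *
        e (-(((∑ i, ((M : ℤ) * J i - (c i).val) * (hs i).val : ℤ) : ℚ) / P)) := by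
  classical
  rw [phi6_apply hP]
  congr 1
  have hP0 : (P : ℤ) ≠ 0 := by exact_mod_cast NeZero.ne P
  have hM0 : (M : ℤ) ≠ 0 := by exact_mod_cast NeZero.ne M
  have hPZ : (P : ℤ) = (M : ℤ) * (N : ℤ) := by exact_mod_cast hP
  -- notation
  set f₂ : Ket n P := qft (phi1Prime P a x y) with hf₂
  set γ : Fin n → ℤ → ℂ := fun i t => cexp (-π * b * ((t : ℂ) - (z' i : ℂ)) ^ 2) with hγ
  set G : (Fin n → ℤ) → ℂ := fun w => ∏ i, γ i (w i) with hG
  set red : (Fin n → ℤ) → (Fin n → ZMod P) := fun w i => ((w i : ℤ) : ZMod P) with hred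
  set E : (Fin n → ZMod P) → ℂ :=
    fun u => e (-(((∑ i, (u i).val * (hs i).val : ℕ) : ℚ) / P)) with hE
  set F : (Fin n → ℤ) → ℂ := fun w => f₂ (red w) * E (red w) * G w with hF
  set p : (Fin n → ZMod P) → Prop := fun v => ∀ i, M ∣ (v i).val + (c i).val with hp
  set q : (Fin n → ℤ) → Prop := fun w => ∀ i, (M : ℤ) ∣ w i + (c i).val with hq
  set S : (Fin n → ℤ) → ℂ := fun w => if q w then F w else 0 with hS
  set lift : (Fin n → ZMod P) → (Fin n → ℤ) → (Fin n → ℤ) :=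
    fun v m i => ((v i).val : ℤ) + P * m i with hlift
  set g : (Fin n → ℤ) → (Fin n → ℤ) := fun J i => (M : ℤ) * J i - (c i).val with hg
  -- bookkeeping facts
  have K1 : ∀ v m, red (lift v m) = v := fun v m => by
    funext i
    simp only [hred, hlift]
    push_cast
    rw [ZMod.natCast_zmod_val, ZMod.natCast_self, zero_mul, add_zero]
  have K2 : ∀ v m, q (lift v m) ↔ p v := fun v m => by
    refine forall_congr' fun i => ?_
    simp only [hlift]
    rw [show ((v i).val : ℤ) + P * m i + (c i).val
        = (((v i).val + (c i).val : ℕ) : ℤ) + M * (N * m i) by rw [hPZ]; push_cast; ring,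
      dvd_add_left (dvd_mul_right _ _), Int.natCast_dvd_natCast]
  have K3 : Function.Injective g := fun J₁ J₂ h => funext fun i => by
    have hi := congr_fun h i
    simp only [hg] at hi
    exact mul_left_cancel₀ hM0 (by linarith)
  have K4 : Function.support S ⊆ Set.range g := fun w hw => by
    have hqw : q w := by
      by_contra h'
      exact hw (by simp only [hS, if_neg h'])
    refine ⟨fun i => (w i + (c i).val) / M, funext fun i => ?_⟩
    simp only [hg]
    rw [Int.mul_ediv_cancel' (hqw i), add_sub_cancel_right]
  have K5 : ∀ J, q (g J) := fun J i => by
    simp only [hg, sub_add_cancel]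
    exact dvd_mul_right _ _
  -- summability
  have hγn : ∀ i, Summable fun t : ℤ => ‖γ i t‖ := fun i => (summable_gaussZ hb (z' i : ℂ)).norm
  have hGn : Summable fun w : Fin n → ℤ => ‖G w‖ := (prod_tsum_int n γ hγn).1
  have hinj : ∀ t : ℤ, Function.Injective fun m : ℤ => t + (P : ℤ) * m := fun t m₁ m₂ h =>
    mul_left_cancel₀ hP0 (add_left_cancel h)
  have hnE : ∀ u, ‖E u‖ = 1 := fun u => norm_e _
  have hSn : Summable S := by
    refine (hGn.mul_left (∑ u : Fin n → ZMod P, ‖f₂ u‖)).of_norm_bounded fun w => ?_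
    have hC : ‖f₂ (red w)‖ ≤ ∑ u : Fin n → ZMod P, ‖f₂ u‖ :=
      Finset.single_le_sum (fun u _ => norm_nonneg (f₂ u)) (Finset.mem_univ (red w))
    have h0 : 0 ≤ (∑ u : Fin n → ZMod P, ‖f₂ u‖) * ‖G w‖ :=
      mul_nonneg (Finset.sum_nonneg fun u _ => norm_nonneg _) (norm_nonneg _)
    by_cases hqw : q w
    · simp only [hS, if_pos hqw, hF, norm_mul, hnE, mul_one]
      exact mul_le_mul_of_nonneg_right hC (norm_nonneg _)
    · simp only [hS, if_neg hqw, norm_zero]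
      exact h0
  -- (A) one `v` at a time: the window is a Gaussian series over `ℤⁿ`
  have hA : ∀ v : Fin n → ZMod P, phi3 P a b x y z' v * E v = ∑' m : Fin n → ℤ, F (lift v m) := by
    intro v
    have hsum : ∀ i, Summable fun m : ℤ => ‖γ i (((v i).val : ℤ) + P * m)‖ := fun i =>
      (hγn i).comp_injective (hinj _)
    have hwin : window P b z' v = ∑' m : Fin n → ℤ, G (lift v m) := by
      have h2 := (prod_tsum_int n (fun i m => γ i (((v i).val : ℤ) + P * m)) hsum).2
      simpa only [window, pgauss, hγ, hG, hlift] using h2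
    have h3 : phi3 P a b x y z' v = f₂ v * window P b z' v := rfl
    rw [h3, hwin, mul_assoc, ← tsum_mul_right, ← tsum_mul_left]
    refine tsum_congr fun m => ?_
    simp only [hF, K1 v m]
    ring
  -- (B) the coset condition is `P`-periodic, so it passes inside the `m`-series
  have hB : ∀ v : Fin n → ZMod P,
      ∑' m : Fin n → ℤ, S (lift v m) = if p v then ∑' m : Fin n → ℤ, F (lift v m) else 0 := by
    intro v
    by_cases hpv : p v
    · rw [if_pos hpv]
      exact tsum_congr fun m => by simp only [hS, if_pos ((K2 v m).mpr hpv)]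
    · rw [if_neg hpv]
      exact (tsum_congr fun m => by simp only [hS, if_neg (mt (K2 v m).mp hpv)]).trans tsum_zero
  -- (E) the summand at `w = MJ − c̃`
  have hEJ : ∀ J : Fin n → ℤ, F (g J)
      = f₂ (fun i => (((M : ℤ) * J i - (c i).val : ℤ) : ZMod P)) *
        cexp (-π * b * ∑ i, ((((M : ℤ) * J i - (c i).val - z' i : ℤ)) : ℂ) ^ 2) *
        e (-(((∑ i, ((M : ℤ) * J i - (c i).val) * (hs i).val : ℤ) : ℚ) / P)) := by
    intro J
    have hph : E (red (g J))
        = e (-(((∑ i, ((M : ℤ) * J i - (c i).val) * (hs i).val : ℤ) : ℚ) / P)) := by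
      simp only [hE, hred, hg]
      exact e_val_repr P (fun i => (M : ℤ) * J i - (c i).val) (fun i => (hs i).val)
    have hga : G (g J) = cexp (-π * b * ∑ i, ((((M : ℤ) * J i - (c i).val - z' i : ℤ)) : ℂ) ^ 2) := by
      simp only [hG, hγ, hg]
      rw [Finset.mul_sum, Complex.exp_sum]
      refine Finset.prod_congr rfl fun i _ => ?_
      congr 1
      push_cast
      ring
    have hfr : f₂ (red (g J)) = f₂ (fun i => (((M : ℤ) * J i - (c i).val : ℤ) : ZMod P)) := by
      simp only [hred, hg]
    rw [hF]
    simp only []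
    rw [hph, hga, hfr]
    ring
  -- assemble
  calc ∑ v ∈ Finset.univ.filter p, phi3 P a b x y z' v * E v
      = ∑ v ∈ Finset.univ.filter p, ∑' m : Fin n → ℤ, F (lift v m) :=
        Finset.sum_congr rfl fun v _ => hA v
    _ = ∑ v, ∑' m : Fin n → ℤ, S (lift v m) := by
        rw [Finset.sum_filter]
        exact Finset.sum_congr rfl fun v _ => (hB v).symm
    _ = ∑' w, S w := (tsum_pi_int_eq_sum_residue P hSn).symm
    _ = ∑' J, S (g J) := (K3.tsum_eq K4).symm
    _ = ∑' J, F (g J) := tsum_congr fun J => if_pos (K5 J)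
    _ = _ := tsum_congr fun J => hEJ J


/-! ### Eq. (27) exactly: the double series over the line index and the lattice index -/

/-- Integer weights version of `e_val_repr`: `e(−Σᵢ sᵢ·(wᵢ mod P)/P) = e(−Σᵢ sᵢwᵢ/P)`. [folklore] -/
private theorem e_val_repr_int (P : ℕ) [NeZero P] (w s : Fin n → ℤ) :
    e (-(((∑ i, s i * ((((w i : ℤ) : ZMod P)).val : ℤ) : ℤ) : ℚ) / P))
      = e (-(((∑ i, s i * w i : ℤ) : ℚ) / P)) := by
  refine e_eq_of_sub_int (∑ i, s i * (w i / P)) ?_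
  have hr : ∀ i, (((((w i : ℤ) : ZMod P)).val : ℕ) : ℤ) = w i - P * (w i / P) := by
    intro i
    rw [ZMod.val_intCast, Int.emod_def]
  have hP0 : (P : ℚ) ≠ 0 := by exact_mod_cast NeZero.ne P
  rw [neg_sub_neg, ← sub_div, div_eq_iff hP0]
  push_cast
  rw [← Finset.sum_sub_distrib, Finset.sum_mul]
  refine Finset.sum_congr rfl fun i _ => ?_
  have hri : (((((w i : ℤ) : ZMod P)).val : ℕ) : ℚ) = (w i : ℚ) - (P : ℚ) * ((w i / P : ℤ) : ℚ) := by
    exact_mod_cast hr i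
  rw [hri]
  ring

/-- The phase of `qft_phi1Prime` in the notation `e`: `exp(−2πi·T/P) = e(−T/P)`. [folklore] -/
private theorem cexp_neg_twoPiI_intCast_div (P : ℕ) (T : ℤ) :
    cexp (-2 * π * I * (T : ℂ) / P) = e (-((T : ℚ) / P)) := by
  rw [e]
  congr 1
  push_cast
  ring

/-- Splitting the two phases of Step 6 along `P = M·N`:
`e(−⟨t, MJ − c̃⟩/P) · e(−⟨MJ − c̃, h̃⟩/P) = e(⟨t + h̃, c̃⟩/P) · e(−⟨t + h̃, J⟩/N)` (`M/P = 1/N`). [folklore] -/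
private theorem e_pair_split {P M N : ℕ} [NeZero P] [NeZero N] (hP : P = M * N)
    (t hv cv J : Fin n → ℤ) :
    e (-(((∑ i, t i * ((M : ℤ) * J i - cv i) : ℤ) : ℚ) / P))
        * e (-(((∑ i, ((M : ℤ) * J i - cv i) * hv i : ℤ) : ℚ) / P))
      = e ((((∑ i, (t i + hv i) * cv i : ℤ)) : ℚ) / P)
        * e (-(((∑ i, (t i + hv i) * J i : ℤ) : ℚ) / N)) := by
  rw [← e_add, ← e_add]
  congr 1
  have h1 : (∑ i, t i * ((M : ℤ) * J i - cv i) : ℤ) = M * (∑ i, t i * J i) - ∑ i, t i * cv i := by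
    rw [Finset.mul_sum, ← Finset.sum_sub_distrib]
    exact Finset.sum_congr rfl fun i _ => by ring
  have h2 : (∑ i, ((M : ℤ) * J i - cv i) * hv i : ℤ) = M * (∑ i, hv i * J i) - ∑ i, hv i * cv i := by
    rw [Finset.mul_sum, ← Finset.sum_sub_distrib]
    exact Finset.sum_congr rfl fun i _ => by ring
  have h3 : (∑ i, (t i + hv i) * cv i : ℤ) = (∑ i, t i * cv i) + ∑ i, hv i * cv i := by
    rw [← Finset.sum_add_distrib]
    exact Finset.sum_congr rfl fun i _ => by ring
  have h4 : (∑ i, (t i + hv i) * J i : ℤ) = (∑ i, t i * J i) + ∑ i, hv i * J i := by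
    rw [← Finset.sum_add_distrib]
    exact Finset.sum_congr rfl fun i _ => by ring
  rw [h1, h2, h3, h4]
  have hN0 : (N : ℚ) ≠ 0 := by exact_mod_cast NeZero.ne N
  have hP0 : (P : ℚ) ≠ 0 := by exact_mod_cast NeZero.ne P
  have hPQ : (P : ℚ) = (M : ℚ) * (N : ℚ) := by exact_mod_cast hP
  rw [hPQ] at hP0 ⊢
  have hM0 : (M : ℚ) ≠ 0 := left_ne_zero_of_mul hP0
  push_cast
  field_simp
  ring

/-- **T3 — eq. (27) exactly: `|φ₆⟩` as a double series over the line index `k ∈ ℤ` and the lattice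
index `J ∈ ℤⁿ`.**  For `P = M·N`, `Re a > 0`, `Re b > 0`, `x ≠ 0` and every `y, z′, h*, c`:
`|φ₆⟩(c) = Mⁿ Σ_{J∈ℤⁿ} Σ_{k∈ℤ} e^{−πa‖kx−y‖²} · e^{−πb‖MJ − c̃ − z′‖²} · e(⟨kx − y + h̃*, c̃⟩/P) ·
e(−⟨kx − y + h̃*, J⟩/N)` — the line Gaussian of Step 1 (rate `a = 1/r² + i/s²`), the window Gaussian of
Step 3 (rate `b`) sampled on the shifted lattice `Mℤⁿ − c̃ − z′`, a phase linear in `c` with modulus `P`,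
and the character `J ↦ e(−⟨kx − y + h̃*, J⟩/N)` of `ℤⁿ/Nℤⁿ`.  Compare eq. (27) p. 27: `Σ_{j∈ℤ} Σ_{k∈ℤⁿ}`
of a Gaussian in `c + Mk + 2Djx − …` times a phase, derived there with `≈` under `M = 2(t²+u²)` and the
constraints C.5–C.6; here `=`, for all parameters.  (`qft_phi1Prime` inserted into `phi6_eq_tsum`; the
representative `(MJ − c̃) mod P` is replaced by `MJ − c̃` inside both phases, and `M/P = 1/N`.)
[cite: ChenQuantumLattice2024, §3.5.6 Lemma 3.27 eq. (27)–(28) p. 27–28; eq. (18) p. 24; eq. (21) p. 25] -/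
theorem phi6_eq27_exact {P M N : ℕ} [NeZero P] [NeZero M] [NeZero N] (hP : P = M * N) {a b : ℂ}
    (ha : 0 < a.re) (hb : 0 < b.re) {x : Fin n → ℤ} (hx : x ≠ 0) (y z' : Fin n → ℤ)
    (hs : Fin n → ZMod N) (c : Fin n → ZMod M) :
    phi6 P N a b x y z' hs c = (M : ℂ) ^ n * ∑' J : Fin n → ℤ, ∑' k : ℤ,
      cexp (-π * a * ∑ i, ((k * x i - y i : ℤ) : ℂ) ^ 2) *
        cexp (-π * b * ∑ i, ((((M : ℤ) * J i - (c i).val - z' i : ℤ)) : ℂ) ^ 2) *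
        e ((((∑ i, (k * x i - y i + (hs i).val) * ((c i).val : ℤ) : ℤ)) : ℚ) / P) *
        e (-(((∑ i, (k * x i - y i + (hs i).val) * J i : ℤ) : ℚ) / N)) := by
  rw [phi6_eq_tsum hP a hb x y z' hs c]
  congr 1
  refine tsum_congr fun J => ?_
  rw [qft_phi1Prime ha hx y, ← tsum_mul_right, ← tsum_mul_right]
  refine tsum_congr fun k => ?_
  rw [cexp_neg_twoPiI_intCast_div,
    e_val_repr_int P (fun i => (M : ℤ) * J i - (c i).val) (fun i => k * x i - y i)]
  rw [show ∀ A B C D : ℂ, A * B * C * D = A * C * (B * D) from fun A B C D => by ring,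
    e_pair_split hP (fun i => k * x i - y i) (fun i => ((hs i).val : ℤ)) (fun i => ((c i).val : ℤ)) J]
  ring

/-! ### The dual form: Poisson summation over the lattice index (where eq. (27)–(29) come from) -/

/-- `Re(b·M²) = Re b · M² > 0` for `M ≥ 1`. [folklore] -/
private theorem re_mul_natCast_sq_pos {b : ℂ} (hb : 0 < b.re) (M : ℕ) [NeZero M] :
    0 < (b * (M : ℂ) ^ 2).re := by
  have h1 : (b * (M : ℂ) ^ 2).re = b.re * (M : ℝ) ^ 2 := by
    rw [show ((M : ℂ) ^ 2) = (((M : ℝ) ^ 2 : ℝ) : ℂ) by push_cast; ring, Complex.re_mul_ofReal]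
  rw [h1]
  exact mul_pos hb (pow_pos (Nat.cast_pos.mpr (Nat.pos_of_ne_zero (NeZero.ne M))) 2)

/-- Fubini on `ℤⁿ × ℤ` for a doubly indexed family dominated by a product of two absolutely summable
families. [folklore] -/
private theorem tsum_comm_dominated {α : ℤ → ℂ} {β : (Fin n → ℤ) → ℂ}
    (hα : Summable fun k => ‖α k‖) (hβ : Summable fun J => ‖β J‖) (F : (Fin n → ℤ) → ℤ → ℂ)
    (h : ∀ J k, ‖F J k‖ ≤ ‖β J‖ * ‖α k‖) :
    ∑' (J : Fin n → ℤ) (k : ℤ), F J k = ∑' (k : ℤ) (J : Fin n → ℤ), F J k := by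
  have h2 : Summable fun p : (Fin n → ℤ) × ℤ => ‖β p.1 * α p.2‖ := Summable.mul_norm hβ hα
  have hU : Summable (Function.uncurry F) :=
    h2.of_norm_bounded fun p => by rw [norm_mul]; exact h p.1 p.2
  exact hU.tsum_comm.symm

/-- **`phi6_eq27_exact` with the order of summation exchanged** (Fubini on `ℤⁿ × ℤ`: the summand is
dominated by the product of the two absolutely convergent Gaussian families `e^{−πa‖kx−y‖²}` (the line,
`summable_lineWindow`) and `e^{−πb‖MJ−c̃−z′‖²}` (the lattice, `summable_gaussZ` coordinatewise), the two
phases being unimodular) and the `J`-free factors pulled out of the inner sum: with `s_k := kx − y + h̃*`,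
`|φ₆⟩(c) = Mⁿ Σ_{k∈ℤ} e^{−πa‖kx−y‖²} e(⟨s_k,c̃⟩/P) · Σ_{J∈ℤⁿ} e^{−πb‖MJ − c̃ − z′‖²} e(−⟨s_k,J⟩/N)`.
[cite: ChenQuantumLattice2024, §3.5.6 Lemma 3.27 eq. (27)–(28) p. 27–28; eq. (18) p. 24] -/
theorem phi6_eq27_exact_comm {P M N : ℕ} [NeZero P] [NeZero M] [NeZero N] (hP : P = M * N) {a b : ℂ}
    (ha : 0 < a.re) (hb : 0 < b.re) {x : Fin n → ℤ} (hx : x ≠ 0) (y z' : Fin n → ℤ)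
    (hs : Fin n → ZMod N) (c : Fin n → ZMod M) :
    phi6 P N a b x y z' hs c = (M : ℂ) ^ n * ∑' k : ℤ,
      cexp (-π * a * ∑ i, ((k * x i - y i : ℤ) : ℂ) ^ 2) *
        e ((((∑ i, (k * x i - y i + (hs i).val) * ((c i).val : ℤ) : ℤ)) : ℚ) / P) *
        ∑' J : Fin n → ℤ, cexp (-π * b * ∑ i, ((((M : ℤ) * J i - (c i).val - z' i : ℤ)) : ℂ) ^ 2) *
          e (-(((∑ i, (k * x i - y i + (hs i).val) * J i : ℤ) : ℚ) / N)) := by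
  have hM0 : (M : ℂ) ≠ 0 := by exact_mod_cast NeZero.ne M
  have hbM := re_mul_natCast_sq_pos hb M
  rw [phi6_eq27_exact hP ha hb hx y z' hs c]
  congr 1
  -- names for the four factors of the summand
  set La : ℤ → ℂ := fun k => cexp (-π * a * ∑ i, ((k * x i - y i : ℤ) : ℂ) ^ 2) with hLa
  set Gb : (Fin n → ℤ) → ℂ := fun J =>
    cexp (-π * b * ∑ i, ((((M : ℤ) * J i - (c i).val - z' i : ℤ)) : ℂ) ^ 2) with hGb
  set eC : ℤ → ℂ := fun k =>
    e ((((∑ i, (k * x i - y i + (hs i).val) * ((c i).val : ℤ) : ℤ)) : ℚ) / P) with heC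
  set eD : (Fin n → ℤ) → ℤ → ℂ := fun J k =>
    e (-(((∑ i, (k * x i - y i + (hs i).val) * J i : ℤ) : ℚ) / N)) with heD
  -- absolute summability of the two Gaussian families
  have hLan : Summable fun k : ℤ => ‖La k‖ := (summable_lineWindow ha hx y).norm
  set γ : Fin n → ℤ → ℂ := fun i t =>
    cexp (-π * b * ((((M : ℤ) * t - (c i).val - z' i : ℤ)) : ℂ) ^ 2) with hγ
  have hγn : ∀ i, Summable fun t : ℤ => ‖γ i t‖ := fun i => by
    refine (summable_gaussZ hbM (((((c i).val : ℤ) + z' i : ℤ) : ℂ) / M)).norm.congr fun t => ?_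
    simp only [hγ]
    congr 2
    push_cast
    field_simp
    ring
  have hGbn : Summable fun J : Fin n → ℤ => ‖Gb J‖ := by
    refine (prod_tsum_int n γ hγn).1.congr fun J => ?_
    simp only [hγ, hGb]
    rw [Finset.mul_sum, Complex.exp_sum]
  calc ∑' (J : Fin n → ℤ) (k : ℤ), La k * Gb J * eC k * eD J k
      = ∑' (k : ℤ) (J : Fin n → ℤ), La k * Gb J * eC k * eD J k :=
        tsum_comm_dominated hLan hGbn (fun J k => La k * Gb J * eC k * eD J k) fun J k =>
          le_of_eq (by simp only [norm_mul, heC, heD, norm_e, mul_one]; ring)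
    _ = ∑' k : ℤ, La k * eC k * ∑' J : Fin n → ℤ, Gb J * eD J k := by
        refine tsum_congr fun k => ?_
        rw [← tsum_mul_left]
        exact tsum_congr fun J => by ring

/-- The summand of the lattice series factorises over the coordinates (`M, N ≥ 1`):
`e^{−πb Σᵢ(MJᵢ − wᵢ)²} · e(−⟨s,J⟩/N) = ∏ᵢ e^{−πbM²(Jᵢ − wᵢ/M)²} · e^{−2πi Jᵢ sᵢ/N}`. [folklore] -/
private theorem lattice_summand_fac {M N : ℕ} [NeZero M] (b : ℂ) (w s J : Fin n → ℤ) :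
    cexp (-π * b * ∑ i, ((((M : ℤ) * J i - w i : ℤ)) : ℂ) ^ 2) * e (-(((∑ i, s i * J i : ℤ) : ℚ) / N))
      = ∏ i, (cexp (-π * (b * (M : ℂ) ^ 2) * (((J i : ℤ) : ℂ) - ((w i : ℤ) : ℂ) / M) ^ 2) *
          cexp (-2 * π * I * ((J i : ℤ) : ℂ) * (((s i : ℤ) : ℂ) / N))) := by
  have hM0 : (M : ℂ) ≠ 0 := by exact_mod_cast NeZero.ne M
  have hgauss : cexp (-π * b * ∑ i, ((((M : ℤ) * J i - w i : ℤ)) : ℂ) ^ 2)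
      = ∏ i, cexp (-π * (b * (M : ℂ) ^ 2) * (((J i : ℤ) : ℂ) - ((w i : ℤ) : ℂ) / M) ^ 2) := by
    rw [Finset.mul_sum, Complex.exp_sum]
    refine Finset.prod_congr rfl fun i _ => ?_
    congr 1
    push_cast
    field_simp
  have hchar : e (-(((∑ i, s i * J i : ℤ) : ℚ) / N))
      = ∏ i, cexp (-2 * π * I * ((J i : ℤ) : ℂ) * (((s i : ℤ) : ℂ) / N)) := by
    rw [e, ← Complex.exp_sum]
    congr 1
    push_cast
    rw [Finset.sum_div, ← Finset.sum_neg_distrib, Finset.mul_sum]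
    exact Finset.sum_congr rfl fun i _ => by ring
  rw [hgauss, hchar, ← Finset.prod_mul_distrib]

/-- **Poisson summation over the lattice index.**  For `Re b > 0`, `M, N ≥ 1`, `w, s ∈ ℤⁿ`:
`Σ_{J∈ℤⁿ} e^{−πb‖MJ − w‖²} · e(−⟨s,J⟩/N)
   = (b·M²)^{−n/2} · ∏ᵢ Σ_{ξ∈ℤ} e^{−(π/(bM²))(ξ + sᵢ/N)²} · e^{−2πi (wᵢ/M)(ξ + sᵢ/N)}`
— coordinatewise the master identity `tsum_cexp_neg_quadratic_shift` (Poisson summation, Lemma 2.4, for the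
complex Gaussian of eq. (1): "centre = phase") with rate `bM²`, centre `wᵢ/M` and twist `sᵢ/N`.  CAUTION: the
dual rate `1/(bM²)` is complex; `Re(1/(bM²)) = Re(bM²)/|bM²|²` is SMALL when `bM²` is nearly imaginary (as
for Chen's parameters, where `|bM²| ≈ 2` and `Re(bM²) = σ²/N²`), so this form by itself is NOT a localisation
statement — the localisation appears only after the lattice chirp is removed, `tsum_lattice_gauss_char_shift`.
[cite: ChenQuantumLattice2024, Lemma 2.4 p. 10; §1.2 eq. (1)–(2) p. 3; §3.5.6 p. 27–29] -/
theorem tsum_lattice_gauss_char {M N : ℕ} [NeZero M] [NeZero N] {b : ℂ} (hb : 0 < b.re)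
    (w s : Fin n → ℤ) :
    ∑' J : Fin n → ℤ, cexp (-π * b * ∑ i, ((((M : ℤ) * J i - w i : ℤ)) : ℂ) ^ 2) *
        e (-(((∑ i, s i * J i : ℤ) : ℚ) / N))
      = (1 / (b * (M : ℂ) ^ 2) ^ (1 / 2 : ℂ)) ^ n *
        ∏ i, ∑' ξ : ℤ, cexp (-π / (b * (M : ℂ) ^ 2) * (ξ + ((s i : ℤ) : ℂ) / N) ^ 2) *
          cexp (-2 * π * I * (((w i : ℤ) : ℂ) / M) * (ξ + ((s i : ℤ) : ℂ) / N)) := by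
  have hbM := re_mul_natCast_sq_pos hb M
  -- the summand factorises over the coordinates (`lattice_summand_fac`)
  set φ : Fin n → ℤ → ℂ := fun i t =>
    cexp (-π * (b * (M : ℂ) ^ 2) * ((t : ℂ) - ((w i : ℤ) : ℂ) / M) ^ 2) *
      cexp (-2 * π * I * (t : ℂ) * (((s i : ℤ) : ℂ) / N)) with hφ
  have hφn : ∀ i, Summable fun t : ℤ => ‖φ i t‖ := fun i => by
    refine (summable_gaussZ hbM (((w i : ℤ) : ℂ) / M)).norm.congr fun t => ?_
    simp only [hφ, norm_mul]
    rw [show -2 * (π : ℂ) * I * (t : ℂ) * (((s i : ℤ) : ℂ) / N) = ((-2 * π * t * s i / N : ℝ) : ℂ) * I by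
      push_cast; ring, Complex.norm_exp_ofReal_mul_I, mul_one]
  calc ∑' J : Fin n → ℤ, cexp (-π * b * ∑ i, ((((M : ℤ) * J i - w i : ℤ)) : ℂ) ^ 2) *
          e (-(((∑ i, s i * J i : ℤ) : ℚ) / N))
      = ∑' J : Fin n → ℤ, ∏ i, φ i (J i) :=
        tsum_congr fun J => by simp only [hφ]; exact lattice_summand_fac b w s J
    _ = ∏ i, ∑' t : ℤ, φ i t := (prod_tsum_int n φ hφn).2.symm
    _ = ∏ i, (1 / (b * (M : ℂ) ^ 2) ^ (1 / 2 : ℂ) *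
          ∑' ξ : ℤ, cexp (-π / (b * (M : ℂ) ^ 2) * (ξ + ((s i : ℤ) : ℂ) / N) ^ 2) *
            cexp (-2 * π * I * (((w i : ℤ) : ℂ) / M) * (ξ + ((s i : ℤ) : ℂ) / N))) :=
        Finset.prod_congr rfl fun i _ => tsum_cexp_neg_quadratic_shift hbM _ _
    _ = _ := by
        rw [Finset.prod_mul_distrib, Finset.prod_const, Finset.card_univ, Fintype.card_fin]

/-- **Removing an even chirp before Poisson summation (exact; the mechanism behind Cond. C.5).**  For
`Re b > 0`, `M, N ≥ 1`, `w, s ∈ ℤⁿ` and ANY `κ ∈ ℤ`: since `e^{2πiκt²} = 1` for `t ∈ ℤ`, on the lattice the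
rate `bM²` of the Gaussian `t ↦ e^{−πbM²(t − wᵢ/M)²}` may be replaced by `bM² + 2κi` at the price of the extra
character `t ↦ e^{−2πi·t·(2κwᵢ/M)}` and the constant `e^{2πiκ(wᵢ/M)²}`; Poisson summation with the NEW rate
(`tsum_cexp_neg_quadratic_shift`) then gives, with `θᵢ := sᵢ/N + 2κwᵢ/M`,
`Σ_{J∈ℤⁿ} e^{−πb‖MJ − w‖²} e(−⟨s,J⟩/N)
   = e^{2πiκ‖w/M‖²} (bM² + 2κi)^{−n/2} ∏ᵢ Σ_{ξ∈ℤ} e^{−(π/(bM²+2κi))(ξ + θᵢ)²} e^{−2πi(wᵢ/M)(ξ + θᵢ)}`.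
`κ = 0` is `tsum_lattice_gauss_char`.  The point: when `Im(bM²) = −2κ` the new rate is the positive REAL
`Re(b)M²`, and then the dual Gaussians `e^{−π(ξ+θᵢ)²/(Re(b)M²)}` ARE narrow (width `√(Re b)·M` in `ξ`), so
only those `θᵢ` within `≈ √(Re b)·M` of an integer carry weight.  For Chen's parameters
(`b = t²r²s²(s²−r²i)/(P²u²(s⁴+r⁴))`, `M = 2N`, `N = t²+u²`, C.2) Cond. C.5 `s²r⁴t²/(u²(s⁴+r⁴)(t²+u²)²) = 2`
says exactly `Im(bM²) = −2`, i.e. `κ = 1`, and the real rate is `Re(b)M² = σ²/N²` (C.6) — see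
`rate_shift_of_C5` and `phi6_karst`.
[cite: ChenQuantumLattice2024, Cond. C.5–C.6 p. 18–19; Lemma 2.4 p. 10; §1.2 eq. (1)–(2) p. 3–4; §3.5.6 p. 27–29] -/
theorem tsum_lattice_gauss_char_shift {M N : ℕ} [NeZero M] [NeZero N] {b : ℂ} (hb : 0 < b.re)
    (w s : Fin n → ℤ) (κ : ℤ) :
    ∑' J : Fin n → ℤ, cexp (-π * b * ∑ i, ((((M : ℤ) * J i - w i : ℤ)) : ℂ) ^ 2) *
        e (-(((∑ i, s i * J i : ℤ) : ℚ) / N))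
      = cexp (2 * π * I * κ * ∑ i, (((w i : ℤ) : ℂ) / M) ^ 2) *
        (1 / (b * (M : ℂ) ^ 2 + 2 * κ * I) ^ (1 / 2 : ℂ)) ^ n *
        ∏ i, ∑' ξ : ℤ,
          cexp (-π / (b * (M : ℂ) ^ 2 + 2 * κ * I)
              * (ξ + (((s i : ℤ) : ℂ) / N + 2 * κ * ((w i : ℤ) : ℂ) / M)) ^ 2) *
          cexp (-2 * π * I * (((w i : ℤ) : ℂ) / M)
              * (ξ + (((s i : ℤ) : ℂ) / N + 2 * κ * ((w i : ℤ) : ℂ) / M))) := by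
  have hbM := re_mul_natCast_sq_pos hb M
  set β : ℂ := b * (M : ℂ) ^ 2 + 2 * κ * I with hβ
  have hβre : 0 < β.re := by
    have h1 : β.re = (b * (M : ℂ) ^ 2).re := by rw [hβ]; simp
    rw [h1]
    exact hbM
  set θ : Fin n → ℂ := fun i => ((s i : ℤ) : ℂ) / N + 2 * κ * ((w i : ℤ) : ℂ) / M with hθ
  -- the original coordinate factors `φ` and the chirp-shifted ones `φ'`
  set φ : Fin n → ℤ → ℂ := fun i t =>
    cexp (-π * (b * (M : ℂ) ^ 2) * ((t : ℂ) - ((w i : ℤ) : ℂ) / M) ^ 2) *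
      cexp (-2 * π * I * (t : ℂ) * (((s i : ℤ) : ℂ) / N)) with hφ
  set φ' : Fin n → ℤ → ℂ := fun i t =>
    cexp (-π * β * ((t : ℂ) - ((w i : ℤ) : ℂ) / M) ^ 2) * cexp (-2 * π * I * (t : ℂ) * θ i) with hφ'
  -- `e^{2πiκt²} = 1` on `ℤ`: the two factorisations differ by the constant `e^{2πiκ(wᵢ/M)²}`
  have hchirp : ∀ i (t : ℤ), φ i t = cexp (2 * π * I * κ * (((w i : ℤ) : ℂ) / M) ^ 2) * φ' i t := by
    intro i t
    simp only [hφ, hφ', hθ, hβ, ← Complex.exp_add]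
    refine Complex.exp_eq_exp_iff_exists_int.mpr ⟨κ * t ^ 2, ?_⟩
    push_cast
    ring
  have hφ'n : ∀ i, Summable fun t : ℤ => ‖φ' i t‖ := fun i => by
    refine (summable_gaussZ hβre (((w i : ℤ) : ℂ) / M)).norm.congr fun t => ?_
    simp only [hφ', norm_mul]
    rw [show -2 * (π : ℂ) * I * (t : ℂ) * θ i
        = ((-2 * π * t * (s i / N + 2 * κ * w i / M) : ℝ) : ℂ) * I by
      simp only [hθ]; push_cast; ring, Complex.norm_exp_ofReal_mul_I, mul_one]
  calc ∑' J : Fin n → ℤ, cexp (-π * b * ∑ i, ((((M : ℤ) * J i - w i : ℤ)) : ℂ) ^ 2) *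
          e (-(((∑ i, s i * J i : ℤ) : ℚ) / N))
      = ∑' J : Fin n → ℤ, ∏ i, φ i (J i) :=
        tsum_congr fun J => by simp only [hφ]; exact lattice_summand_fac b w s J
    _ = ∑' J : Fin n → ℤ, (∏ i : Fin n, cexp (2 * π * I * κ * (((w i : ℤ) : ℂ) / M) ^ 2)) *
          ∏ i, φ' i (J i) :=
        tsum_congr fun J => by
          rw [← Finset.prod_mul_distrib]
          exact Finset.prod_congr rfl fun i _ => hchirp i (J i)
    _ = (∏ i : Fin n, cexp (2 * π * I * κ * (((w i : ℤ) : ℂ) / M) ^ 2)) * ∏ i, ∑' t : ℤ, φ' i t := by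
        rw [tsum_mul_left, ← (prod_tsum_int n φ' hφ'n).2]
    _ = cexp (2 * π * I * κ * ∑ i, (((w i : ℤ) : ℂ) / M) ^ 2) *
          ∏ i, (1 / β ^ (1 / 2 : ℂ) * ∑' ξ : ℤ, cexp (-π / β * (ξ + θ i) ^ 2) *
            cexp (-2 * π * I * (((w i : ℤ) : ℂ) / M) * (ξ + θ i))) := by
        rw [Finset.mul_sum, Complex.exp_sum]
        congr 1
        exact Finset.prod_congr rfl fun i _ => tsum_cexp_neg_quadratic_shift hβre _ _
    _ = _ := by
        rw [Finset.prod_mul_distrib, Finset.prod_const, Finset.card_univ, Fintype.card_fin, ← mul_assoc]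

/-- **Cond. C.5 is exactly `Im(b·M²) = −2`, and then `b·M² + 2i = σ²/N² > 0`.**  With Chen's rate
`b = t²r²s²(s² − r²i)/(P²u²(s⁴+r⁴))` of the complex Gaussian in `|φ₃⟩`, `|φ₄⟩`, `|φ₆⟩` (`= t²/(P²‖x‖²a)` for
the Step-1 rate `a = 1/r² + i/s²`, `u = ‖x‖`; `phi4_eq_tsum`, `phi6_eq27_exact`), `N = t² + u²`, `P = M·N`
(Cond. C.2) and
`σ² = r²s⁴t²/(u²(r⁴+s⁴))` (Cond. C.6), Cond. C.5 `s²r⁴/(u²(s⁴+r⁴)) · t²/(t²+u²)² = 2` ("the key condition for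
creating the Karst wave", p. 18) is equivalent to `Im(b·M²) = −2` and gives `b·M² + 2i = σ²/N²`, a positive
real: exactly the hypothesis under which `phi6_karst` with `κ = 1` has REAL dual rate.  Pure real algebra.
[cite: ChenQuantumLattice2024, Cond. C.2, C.5, C.6 p. 18–19; §3.5.6 p. 27; eq. (21) p. 25] -/
theorem rate_shift_of_C5 {r s t u M N P : ℝ} (hu : u ≠ 0) (hM : M ≠ 0) (hN0 : N ≠ 0)
    (hrs : s ^ 4 + r ^ 4 ≠ 0) (hN : N = t ^ 2 + u ^ 2) (hP : P = M * N)
    (hC5 : s ^ 2 * r ^ 4 / (u ^ 2 * (s ^ 4 + r ^ 4)) * (t ^ 2 / (t ^ 2 + u ^ 2) ^ 2) = 2) :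
    ((t ^ 2 * r ^ 2 * s ^ 2 / (P ^ 2 * u ^ 2 * (s ^ 4 + r ^ 4)) : ℝ) : ℂ) * ((s ^ 2 : ℝ) - (r ^ 2 : ℝ) * I)
        * (M : ℂ) ^ 2 + 2 * I
      = (((r ^ 2 * s ^ 4 * t ^ 2 / (u ^ 2 * (r ^ 4 + s ^ 4))) / N ^ 2 : ℝ) : ℂ) := by
  rw [← hN] at hC5
  have hP0 : P ≠ 0 := by rw [hP]; exact mul_ne_zero hM hN0
  have hrs' : r ^ 4 + s ^ 4 ≠ 0 := by rwa [add_comm]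
  have hC5' : s ^ 2 * r ^ 4 * t ^ 2 = 2 * (u ^ 2 * (s ^ 4 + r ^ 4)) * N ^ 2 := by
    field_simp at hC5
    linear_combination hC5
  -- real and imaginary parts
  have hre : t ^ 2 * r ^ 2 * s ^ 2 / (P ^ 2 * u ^ 2 * (s ^ 4 + r ^ 4)) * s ^ 2 * M ^ 2
      = r ^ 2 * s ^ 4 * t ^ 2 / (u ^ 2 * (r ^ 4 + s ^ 4)) / N ^ 2 := by
    rw [hP]
    field_simp
    ring
  have him : -(t ^ 2 * r ^ 2 * s ^ 2 / (P ^ 2 * u ^ 2 * (s ^ 4 + r ^ 4)) * r ^ 2 * M ^ 2) + 2 = 0 := by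
    rw [hP]
    field_simp
    linear_combination (-1 : ℝ) * hC5'
  rw [show ((M : ℝ) : ℂ) ^ 2 = ((M ^ 2 : ℝ) : ℂ) by push_cast; ring]
  apply Complex.ext
  · simp only [Complex.add_re, Complex.mul_re, Complex.mul_im, Complex.sub_re, Complex.sub_im,
      Complex.ofReal_re, Complex.ofReal_im, Complex.I_re, Complex.I_im, Complex.re_ofNat,
      Complex.im_ofNat]
    linear_combination hre
  · simp only [Complex.add_im, Complex.mul_re, Complex.mul_im, Complex.sub_re, Complex.sub_im,
      Complex.ofReal_re, Complex.ofReal_im, Complex.I_re, Complex.I_im, Complex.re_ofNat,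
      Complex.im_ofNat]
    linear_combination him

/-- **Step 6 in dual form (exact), complex rate.**  `P = M·N`, `Re a, Re b > 0`, `x ≠ 0`; for every
`y, z′, h*, c`, with `s_k := kx − y + h̃* ∈ ℤⁿ`:
`|φ₆⟩(c) = Mⁿ (bM²)^{−n/2} Σ_{k∈ℤ} e^{−πa‖kx−y‖²} e(⟨s_k, c̃⟩/P)
            · ∏ᵢ Σ_{ξ∈ℤ} e^{−(π/(bM²))(ξ + s_{k,i}/N)²} e^{−2πi((c̃ᵢ+z′ᵢ)/M)(ξ + s_{k,i}/N)}`
— `phi6_eq27_exact_comm` followed by Poisson summation over the lattice index `J` (`tsum_lattice_gauss_char`).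
CAUTION (see there): for Chen's parameters `b` is nearly imaginary (`Re b/|b| = s²/√(s⁴+r⁴) ≪ 1`,
`|bM²| ≈ 2`), so the dual rate `1/(bM²)` has small real part and this form does NOT by itself exhibit the
localisation of `c` asserted in Lemmas 3.27–3.29; that requires removing the lattice chirp first, which is
what Cond. C.5 makes possible: `phi6_karst`.  The paper's `≈`-statements (27)–(29) themselves (parameter
choices, truncations, `2^{−Ω(n)}` errors) are NOT reproduced.
[cite: ChenQuantumLattice2024, §3.5.6 Lemma 3.27–3.29, eq. (27)–(29), p. 27–29; Lemma 2.4 p. 10] -/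
theorem phi6_dual {P M N : ℕ} [NeZero P] [NeZero M] [NeZero N] (hP : P = M * N) {a b : ℂ}
    (ha : 0 < a.re) (hb : 0 < b.re) {x : Fin n → ℤ} (hx : x ≠ 0) (y z' : Fin n → ℤ)
    (hs : Fin n → ZMod N) (c : Fin n → ZMod M) :
    phi6 P N a b x y z' hs c = (M : ℂ) ^ n * (1 / (b * (M : ℂ) ^ 2) ^ (1 / 2 : ℂ)) ^ n *
      ∑' k : ℤ, cexp (-π * a * ∑ i, ((k * x i - y i : ℤ) : ℂ) ^ 2) *
        e ((((∑ i, (k * x i - y i + (hs i).val) * ((c i).val : ℤ) : ℤ)) : ℚ) / P) *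
        ∏ i, ∑' ξ : ℤ,
          cexp (-π / (b * (M : ℂ) ^ 2) * (ξ + ((k * x i - y i + (hs i).val : ℤ) : ℂ) / N) ^ 2) *
          cexp (-2 * π * I * (((((c i).val : ℤ) + z' i : ℤ) : ℂ) / M)
            * (ξ + ((k * x i - y i + (hs i).val : ℤ) : ℂ) / N)) := by
  rw [phi6_eq27_exact_comm hP ha hb hx y z' hs c, mul_assoc]
  congr 1
  rw [← tsum_mul_left]
  refine tsum_congr fun k => ?_
  simp only [sub_sub]
  rw [tsum_lattice_gauss_char (M := M) (N := N) (n := n) hb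
    (fun i => ((c i).val : ℤ) + z' i) (fun i => k * x i - y i + (hs i).val)]
  ring

/-- **Step 6, the Karst-wave mechanism (exact; where Cond. C.5 enters).**  `P = M·N`, `Re a, Re b > 0`,
`x ≠ 0`; for every `y, z′, h*, c` and EVERY `κ ∈ ℤ`, with `s_k := kx − y + h̃*`, `w := c̃ + z′` and
`θ_{k,i} := s_{k,i}/N + 2κwᵢ/M`:
`|φ₆⟩(c) = Mⁿ e^{2πiκ‖w/M‖²} (bM² + 2κi)^{−n/2} Σ_{k∈ℤ} e^{−πa‖kx−y‖²} e(⟨s_k, c̃⟩/P)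
            · ∏ᵢ Σ_{ξ∈ℤ} e^{−(π/(bM²+2κi))(ξ + θ_{k,i})²} e^{−2πi(wᵢ/M)(ξ + θ_{k,i})}`
(`phi6_eq27_exact_comm` + `tsum_lattice_gauss_char_shift`: the chirp `e^{2πiκ‖J‖²} = 1` on `ℤⁿ` lets one
trade the rate `b` for `b + 2κi/M²` before Poisson summation; `κ = 0` is `phi6_dual`).  READING for Chen's
parameters (not used in the proof): by `rate_shift_of_C5`, Cond. C.5 is exactly `Im(bM²) = −2`, so for
`κ = 1` the rate `bM² + 2i = Re(b)M² = σ²/N²` is a small positive REAL and the dual Gaussians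
`e^{−π(N/σ)²(ξ + θ_{k,i})²}` are genuinely narrow (width `σ/N` in `ξ`), so only those `(k, c)` with every
`θ_{k,i}` within `≈ σ/N` of an integer carry weight; as `M = 2N`, `θ_{k,i} = 2(kxᵢ − yᵢ + h̃*ᵢ + c̃ᵢ + z′ᵢ)/M`,
i.e. `|φ₆⟩(c)` lives, up to Gaussian tails of width `σ` per coordinate, on
`c ≡ −(z′ + h* − y) − kx (mod M/2)` for the line indices `k` — the `(M/2)·k_c − (z′ + h* − y)`
lattice of centres and the "Gaussian balls of width σ" of eq. (27)–(29) / Lemma 3.27 (whose remaining terms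
along `x` come from the sum over `k`, which is NOT resummed here).  The identity holds for all `b` with
`Re b > 0` and all `κ`; the `≈`-statements (27)–(29), the truncations and the `2^{−Ω(n)}` error terms of
Lemmas 3.27–3.29 are NOT reproduced.
[cite: ChenQuantumLattice2024, §3.5.6 Lemma 3.27–3.29, eq. (27)–(29), p. 27–29; Cond. C.5–C.6 p. 18–19;
§1.2 p. 3–4; Lemma 2.4 p. 10] -/
theorem phi6_karst {P M N : ℕ} [NeZero P] [NeZero M] [NeZero N] (hP : P = M * N) {a b : ℂ}
    (ha : 0 < a.re) (hb : 0 < b.re) {x : Fin n → ℤ} (hx : x ≠ 0) (y z' : Fin n → ℤ)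
    (hs : Fin n → ZMod N) (c : Fin n → ZMod M) (κ : ℤ) :
    phi6 P N a b x y z' hs c = (M : ℂ) ^ n *
      (cexp (2 * π * I * κ * ∑ i, ((((((c i).val : ℤ) + z' i : ℤ)) : ℂ) / M) ^ 2) *
        (1 / (b * (M : ℂ) ^ 2 + 2 * κ * I) ^ (1 / 2 : ℂ)) ^ n) *
      ∑' k : ℤ, cexp (-π * a * ∑ i, ((k * x i - y i : ℤ) : ℂ) ^ 2) *
        e ((((∑ i, (k * x i - y i + (hs i).val) * ((c i).val : ℤ) : ℤ)) : ℚ) / P) *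
        ∏ i, ∑' ξ : ℤ,
          cexp (-π / (b * (M : ℂ) ^ 2 + 2 * κ * I)
              * (ξ + ((((k * x i - y i + (hs i).val : ℤ)) : ℂ) / N
                      + 2 * κ * (((((c i).val : ℤ) + z' i : ℤ)) : ℂ) / M)) ^ 2) *
          cexp (-2 * π * I * ((((((c i).val : ℤ) + z' i : ℤ)) : ℂ) / M)
              * (ξ + ((((k * x i - y i + (hs i).val : ℤ)) : ℂ) / N
                      + 2 * κ * (((((c i).val : ℤ) + z' i : ℤ)) : ℂ) / M))) := by
  rw [phi6_eq27_exact_comm hP ha hb hx y z' hs c, mul_assoc]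
  congr 1
  rw [← tsum_mul_left]
  refine tsum_congr fun k => ?_
  simp only [sub_sub]
  rw [tsum_lattice_gauss_char_shift (M := M) (N := N) (n := n) hb
    (fun i => ((c i).val : ℤ) + z' i) (fun i => k * x i - y i + (hs i).val) κ]
  ring

end StepSix

end

end Literature.Computability.Cryptography.Chen2024
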